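import Summits.NavierStokesRegularity.NavierStokesRegularity.Theorems.ExtremiserTransiencePerFlowScaleLockReduction
import Literature.Analysis.FluidPDE.ClassicalGradientSmoothing
import Literature.Analysis.FluidPDE.NSLerayBlowupRateTopHolds
import Literature.Analysis.FluidPDE.NSCriticalClosureProofs
import Literature.Analysis.FluidPDE.NSCriticalClosureTao
import Literature.Analysis.FluidPDE.TaoLocalisationHolds
import Literature.Analysis.FluidPDE.NSLerayHopfSereginProofs
import HarnessLib

/-!
# Route `ExtremiserTransience`, LINE g4-α «per-flow-tangent» (ns-idea-5 g4): THE SCALE LOCK —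
# hypotheses (G) and (Λ) of `scaleLock_of_rates` DISCHARGED from the tree

`--supports stmt-NavierStokesRegularity-26568` (`TangentExtremalExtraction`; skeleton v2 stub `stub_scaleLock`).

`scaleLock_of_rates` (`…PerFlowScaleLockReduction.lean`) derives the two-sided scale lock at near-efficient late
times from (G) a gradient Type-I rate, (Λ) Leray's lower blow-up rate and (E) Leray-rate enstrophy at efficient
times. Here (G) and (Λ) are PROVED for the flows of the route (Type-I, non-extending, classical Leray–Hopf with
rapidly decaying datum), so that the lock hinges on (E) ALONE:

* `gradTypeIRate_of_typeIRate` — (G) from the Type-I rate: the tree's quantitative KNSS gradient smoothing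
  `exists_norm_fderiv_le_of_speed_le` (`‖∇u(t)‖ ≤ C_K G²/ν` once `u` is bounded by `G` on `[0,T']`, `t > ν/G²`),
  applied on `[0,(t+T)/2]` with `G = B₀ + C√ν/√((T−t)/2)` (`B₀` a bound on an early closed slab from Tao's
  cover `RungReynoldsOne.stub_taoCover` + `exists_forall_norm_le_of_hasBoundedSobolevNormsOn`; the `L²` slice bound
  from the Leray–Hopf energy inequality `eLpNorm_two_le_of_isLerayHopfOn`), gives `(T−t)‖∇u(t,x)‖ ≤ C₁` near `T`.
* `lerayLowerRate_of_not_extends` — (Λ) for a non-extending solution: Leray's `‖u(t)‖_∞ ≥ c√ν/√(T−t)`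
  (`leray_blowup_rate_top_holds`, maximality `⟨hsol, hext⟩`, sub-strip boundedness
  `eLpNorm_uncurry_top_lt_top_of_tao2011 tao2011_hasBoundedSobolevNormsOn_holds`), in the pointwise-witness form
  `∃ x, (c/2)√ν ≤ √(T−t)‖u(t,x)‖`.
* `scaleLock_of_enstrophyRate` — for the route's flows: (E) ⇒ the conclusion of `stub_scaleLock` (non-null sets of
  strictly `m`-efficient late times with `c₁ν(T−t)P ≤ Z ≤ c₂ν(T−t)P`, `0 < c₁ ≤ c₂` independent of `m, t₁`).

So skeleton-v2's `stub_scaleLock` is REDUCED TO (E): "at a non-null set of strictly m-efficient late times the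
enstrophy is within a constant of Leray's minimal rate, `Z(t)√(T−t) ≤ Aν√ν`" — whose efficiency half is the landed
`nearEfficient_recurrence_of_not_perFlow`; the enstrophy-rate half is the open content (vorticity concentration at
the parabolic scale). HONEST FRAMING: conditional on (E); nothing about Navier–Stokes regularity or blow-up is
proved; items 26567/26568 stay open. References: Leray 1934 §19 (3.9); Koch–Nadirashvili–Seregin–Šverák 2009
Prop. 4.1/(4.10); Tao 2013 Cor. 11.1; Ożański–Pooley 2018 Cor. 6.25. [folklore]
-/

noncomputable section
open Set Filter Topology MeasureTheory Function
open scoped InnerProductSpace RealInnerProductSpace ENNReal NNReal ContDiff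
open Literature.Analysis.FluidPDE

namespace Summit.NavierStokesRegularity.NavierStokesRegularity.Theorems.DepletionLadder.PerFlow
set_option linter.dupNamespace false
set_option linter.style.longLine false

/-- **(G) Gradient Type-I rate from the Type-I rate** (KNSS 2009 (4.10), quantitative, via
`exists_norm_fderiv_le_of_speed_le`): a classical Leray–Hopf rapidly-decaying-datum solution on `[0,T)` with the
eventual rate `√(T−t)‖u(t,x)‖ ≤ C√ν` satisfies `(T−t)‖∇u(t,x)‖ ≤ C₁` for all `x` and all `t < T` close to `T`.
[cite: KochNadirashviliSereginSverak2009, Prop. 4.1 and (4.10) (arXiv:0709.3599 §4)] -/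
theorem gradTypeIRate_of_typeIRate {C ν T : ℝ} (hC : 0 < C) (hν : 0 < ν) (hT : 0 < T)
    {u : ℝ → EuclideanSpace ℝ (Fin 3) → EuclideanSpace ℝ (Fin 3)} {p : ℝ → EuclideanSpace ℝ (Fin 3) → ℝ}
    (hsol : IsClassicalNSSolutionOn (Ico 0 T) ν 0 u p) (hLH : IsLerayHopfOn T ν 0 (u 0) u)
    (hdec : HasRapidSpatialDecay (u 0))
    (hrate : ∀ᶠ t in 𝓝[<] T, ∀ x, Real.sqrt (T - t) * ‖u t x‖ ≤ C * Real.sqrt ν) :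
    ∃ C₁ : ℝ, 0 < C₁ ∧ ∀ᶠ t in 𝓝[<] T, ∀ x, (T - t) * ‖fderiv ℝ (u t) x‖ ≤ C₁ := by
  obtain ⟨Cg, hCg⟩ := exists_norm_fderiv_le_of_speed_le
  obtain ⟨a, haT, hsub⟩ := mem_nhdsLT_iff_exists_Ioo_subset.1 hrate
  have haT' : a < T := haT
  -- an early closed slab `[0, a₀]`, `a < a₀ < T`, `0 < a₀`, on which `u` is bounded by `B₀`
  set a₀ : ℝ := (max a 0 + T) / 2 with ha₀
  have hmax0 : max a 0 < T := max_lt haT' hT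
  have ha₀T : a₀ < T := by rw [ha₀]; linarith
  have ha₀pos : 0 < a₀ := by rw [ha₀]; linarith [le_max_right a 0]
  have haa₀ : a < a₀ := by rw [ha₀]; linarith [le_max_left a 0]
  obtain ⟨q, hsolq, hBq, -, -⟩ := RungReynoldsOne.stub_taoCover hν hT hsol hLH hdec ⟨ha₀pos, ha₀T⟩
  obtain ⟨B₀, hB₀0, hB₀⟩ := exists_forall_norm_le_of_hasBoundedSobolevNormsOn hsolq hBq
  -- the energy bound for the `L²` slices
  set K : ℝ≥0∞ := ENNReal.ofReal (2 * VectorCalculus.kineticEnergy (u 0)) ^ (2⁻¹ : ℝ) with hK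
  have hKtop : K ≠ ⊤ := ENNReal.rpow_ne_top_of_nonneg (by norm_num : (0:ℝ) ≤ 2⁻¹) ENNReal.ofReal_ne_top
  have hL2 : ∀ s ∈ Icc 0 T, eLpNorm (u s) 2 volume ≤ K := fun s hs =>
    eLpNorm_two_le_of_isLerayHopfOn hν.le hLH hs
  -- the constant
  set Cg' : ℝ := max Cg 0 with hCg'
  have hCg'0 : 0 ≤ Cg' := le_max_right _ _
  set C₁ : ℝ := Cg' * (2 * B₀ ^ 2 * T + 4 * C ^ 2 * ν) / ν + 1 with hC₁
  have hC₁pos : 0 < C₁ := by rw [hC₁]; positivity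
  refine ⟨C₁, hC₁pos, ?_⟩
  have hlt3 : T * (1 - C ^ 2) < T := by nlinarith [mul_pos hT (pow_pos hC 2)]
  filter_upwards [Ioo_mem_nhdsLT ha₀T, Ioo_mem_nhdsLT (half_lt_self hT), Ioo_mem_nhdsLT hlt3] with t ht₁ ht₂ ht₃
  intro x
  have htT : t < T := ht₁.2
  have ht0 : 0 < t := lt_trans (half_pos hT) ht₂.1
  set r : ℝ := T - t with hr
  have hrpos : 0 < r := by rw [hr]; linarith
  have hrT : r ≤ T := by rw [hr]; linarith
  have hrC : r < 2 * t * C ^ 2 := by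
    have h1 : T - t < C ^ 2 * T := by have := ht₃.1; nlinarith
    have h2 : C ^ 2 * T < C ^ 2 * (2 * t) := mul_lt_mul_of_pos_left (by linarith [ht₂.1]) (by positivity)
    rw [hr]; linarith
  -- the window `[0, t⁺]`, `t⁺ = (t+T)/2`, and the bound `G`
  set tp : ℝ := (t + T) / 2 with htp
  have htpT : tp < T := by rw [htp]; linarith
  have http : t < tp := by rw [htp]; linarith
  have htp0 : 0 < tp := ht0.trans http
  have hTtp : T - tp = r / 2 := by rw [htp, hr]; ring
  set ρ : ℝ := Real.sqrt (T - tp) with hρ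
  have hρpos : 0 < ρ := Real.sqrt_pos.2 (by rw [hTtp]; positivity)
  have hρ2 : ρ ^ 2 = r / 2 := by rw [hρ, Real.sq_sqrt (by rw [hTtp]; positivity), hTtp]
  set G : ℝ := B₀ + C * Real.sqrt ν / ρ with hG
  have hGge : C * Real.sqrt ν / ρ ≤ G := le_add_of_nonneg_left hB₀0
  have hq : (C * Real.sqrt ν / ρ) ^ 2 = 2 * C ^ 2 * ν / r := by
    rw [div_pow, mul_pow, Real.sq_sqrt hν.le, hρ2]; field_simp
  have hGpos : 0 < G := lt_of_lt_of_le (by positivity) hGge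
  have hG2 : 2 * C ^ 2 * ν / r ≤ G ^ 2 := by
    rw [← hq]; exact pow_le_pow_left₀ (by positivity) hGge 2
  have hG2' : G ^ 2 ≤ 2 * B₀ ^ 2 + 2 * (2 * C ^ 2 * ν / r) := by
    rw [← hq, hG]; nlinarith [sq_nonneg (B₀ - C * Real.sqrt ν / ρ)]
  -- `u` is bounded by `G` on `[0, t⁺]`
  have hbd : ∀ s ∈ Icc 0 tp, ∀ y, ‖u s y‖ ≤ G := by
    intro s hs y
    rcases le_or_gt s a₀ with hsa | hsa
    · have h0 : (0:ℝ) ≤ C * Real.sqrt ν / ρ := by positivity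
      linarith [hB₀ s ⟨hs.1, hsa⟩ y]
    · have hsT : s < T := lt_of_le_of_lt hs.2 htpT
      have h := hsub ⟨haa₀.trans hsa, hsT⟩ y
      have hρle : ρ ≤ Real.sqrt (T - s) := Real.sqrt_le_sqrt (by linarith [hs.2])
      have hTs : 0 < Real.sqrt (T - s) := Real.sqrt_pos.2 (by linarith)
      have h1 : ρ * ‖u s y‖ ≤ C * Real.sqrt ν :=
        (mul_le_mul_of_nonneg_right hρle (norm_nonneg _)).trans h
      have h2 : ‖u s y‖ ≤ C * Real.sqrt ν / ρ := by rw [le_div_iff₀ hρpos, mul_comm]; exact h1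
      exact h2.trans hGge
  have hL2' : ∀ s ∈ Icc 0 tp, eLpNorm (u s) 2 volume ≤ K := fun s hs => hL2 s ⟨hs.1, hs.2.trans htpT.le⟩
  -- `t` lies in the window `(ν/G², t⁺)`
  have hlow : ν / G ^ 2 < t := by
    rw [div_lt_iff₀ (by positivity : (0:ℝ) < G ^ 2)]
    have h1 : t * (2 * C ^ 2 * ν / r) ≤ t * G ^ 2 := mul_le_mul_of_nonneg_left hG2 ht0.le
    have h2 : ν < t * (2 * C ^ 2 * ν / r) := by
      rw [mul_div_assoc', lt_div_iff₀ hrpos]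
      calc ν * r < ν * (2 * t * C ^ 2) := mul_lt_mul_of_pos_left hrC hν
        _ = t * (2 * C ^ 2 * ν) := by ring
    linarith
  have hgrad : ‖fderiv ℝ (u t) x‖ ≤ Cg * G ^ 2 / ν :=
    hCg hν hGpos hsol htp0 htpT hbd hKtop hL2' t ⟨hlow, http⟩ x
  -- the arithmetic: `(T - t) · Cg G²/ν ≤ Cg' (2B₀²T + 4C²ν)/ν < C₁`
  have hgrad' : ‖fderiv ℝ (u t) x‖ ≤ Cg' * G ^ 2 / ν := by
    refine hgrad.trans ?_
    exact div_le_div_of_nonneg_right (mul_le_mul_of_nonneg_right (le_max_left _ _) (by positivity)) hν.le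
  have hrG : r * G ^ 2 ≤ 2 * B₀ ^ 2 * T + 4 * C ^ 2 * ν := by
    calc r * G ^ 2 ≤ r * (2 * B₀ ^ 2 + 2 * (2 * C ^ 2 * ν / r)) := mul_le_mul_of_nonneg_left hG2' hrpos.le
      _ = 2 * B₀ ^ 2 * r + 4 * C ^ 2 * ν := by field_simp; ring
      _ ≤ 2 * B₀ ^ 2 * T + 4 * C ^ 2 * ν := by nlinarith [sq_nonneg B₀]
  calc (T - t) * ‖fderiv ℝ (u t) x‖ = r * ‖fderiv ℝ (u t) x‖ := by rw [hr]
    _ ≤ r * (Cg' * G ^ 2 / ν) := mul_le_mul_of_nonneg_left hgrad' hrpos.le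
    _ = Cg' * (r * G ^ 2) / ν := by ring
    _ ≤ Cg' * (2 * B₀ ^ 2 * T + 4 * C ^ 2 * ν) / ν :=
        div_le_div_of_nonneg_right (mul_le_mul_of_nonneg_left hrG hCg'0) hν.le
    _ ≤ C₁ := by rw [hC₁]; linarith

/-- **(Λ) Leray's lower blow-up rate for a non-extending solution, pointwise-witness form** (Leray 1934 §19 (3.9),
through `leray_blowup_rate_top_holds`): some `c₀ > 0` with `∃ x, c₀√ν ≤ √(T−t)‖u(t,x)‖` for every `t ∈ [0,T)`.
[cite: Leray1934, §19 (3.8)–(3.9) p. 224] -/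
theorem lerayLowerRate_of_not_extends {ν T : ℝ} (hν : 0 < ν) (hT : 0 < T)
    {u : ℝ → EuclideanSpace ℝ (Fin 3) → EuclideanSpace ℝ (Fin 3)} {p : ℝ → EuclideanSpace ℝ (Fin 3) → ℝ}
    (hsol : IsClassicalNSSolutionOn (Ico 0 T) ν 0 u p) (hLH : IsLerayHopfOn T ν 0 (u 0) u)
    (hdec : HasRapidSpatialDecay (u 0)) (hext : ¬ HasSmoothExtensionPast ν 0 u T) :
    ∃ c₀ : ℝ, 0 < c₀ ∧ ∀ t ∈ Set.Ico 0 T, ∃ x, c₀ * Real.sqrt ν ≤ Real.sqrt (T - t) * ‖u t x‖ := by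
  obtain ⟨c, hc, hrate⟩ := leray_blowup_rate_top_holds
  have hmax : IsMaximalSmoothSolution ν 0 u p T := ⟨hsol, hext⟩
  have hbdd : ∀ T' ∈ Ioo 0 T, eLpNorm (uncurry u) ⊤
      ((volume : Measure (ℝ × EuclideanSpace ℝ (Fin 3))).restrict (Icc 0 T' ×ˢ univ)) < ⊤ :=
    eLpNorm_uncurry_top_lt_top_of_tao2011 tao2011_hasBoundedSobolevNormsOn_holds hν hsol hLH hdec
  have hr := hrate ν T hν hT u p hmax hLH hbdd
  refine ⟨c / 2, by positivity, fun t ht => ?_⟩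
  by_contra hno
  push Not at hno
  have hTt : 0 < T - t := sub_pos.2 ht.2
  have hsq : 0 < Real.sqrt (T - t) := Real.sqrt_pos.2 hTt
  have hM : ∀ x, ‖u t x‖ ≤ c / 2 * Real.sqrt ν / Real.sqrt (T - t) := by
    intro x
    rw [le_div_iff₀ hsq]
    have h := hno x
    linarith [mul_comm (Real.sqrt (T - t)) ‖u t x‖]
  have h2 : eLpNorm (u t) ⊤ volume ≤ ENNReal.ofReal (c / 2 * Real.sqrt ν / Real.sqrt (T - t)) := by
    rw [eLpNorm_exponent_top]
    exact eLpNormEssSup_le_of_ae_bound (Eventually.of_forall hM)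
  have hpos : 0 ≤ c / 2 * Real.sqrt ν / Real.sqrt (T - t) := by positivity
  have h4 : c * Real.sqrt ν / Real.sqrt (T - t) ≤ c / 2 * Real.sqrt ν / Real.sqrt (T - t) :=
    (ENNReal.ofReal_le_ofReal_iff hpos).1 ((hr t ht).trans h2)
  have h5 := mul_le_mul_of_nonneg_right h4 hsq.le
  rw [div_mul_cancel₀ _ hsq.ne', div_mul_cancel₀ _ hsq.ne'] at h5
  have hK : 0 < c * Real.sqrt ν := mul_pos hc (Real.sqrt_pos.2 hν)
  linarith

/-- **The scale lock from Leray-rate enstrophy at efficient times** — for the flows of the route (Type-I rate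
`√(T−t)‖u‖ ≤ C√ν` eventually, no smooth extension past `T`), hypothesis (E) ALONE gives the conclusion of
skeleton-v2's `stub_scaleLock`: `∃ 0 < c₁ ≤ c₂`, for every `0 ≤ m < κ⋆` and `t₁ < T` the late times that are
strictly `m`-efficient with `c₁ν(T−t)P ≤ Z ≤ c₂ν(T−t)P` form a non-null set ((G), (Λ) discharged by
`gradTypeIRate_of_typeIRate`, `lerayLowerRate_of_not_extends`; then `scaleLock_of_rates`). [folklore] -/
theorem scaleLock_of_enstrophyRate {C ν T : ℝ} (hC : 0 < C) (hν : 0 < ν) (hT : 0 < T)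
    {u : ℝ → EuclideanSpace ℝ (Fin 3) → EuclideanSpace ℝ (Fin 3)} {p : ℝ → EuclideanSpace ℝ (Fin 3) → ℝ}
    (hsol : IsClassicalNSSolutionOn (Ico 0 T) ν 0 u p) (hLH : IsLerayHopfOn T ν 0 (u 0) u)
    (hdec : HasRapidSpatialDecay (u 0))
    (hrate : ∀ᶠ t in 𝓝[<] T, ∀ x, Real.sqrt (T - t) * ‖u t x‖ ≤ C * Real.sqrt ν)
    (hext : ¬ HasSmoothExtensionPast ν 0 u T)
    (henst : ∃ A : ℝ, ∀ m : ℝ, 0 ≤ m → m < sInf {κ : ℝ | (∀ (v : EuclideanSpace ℝ (Fin 3) → EuclideanSpace ℝ (Fin 3)) (M B : ℝ), ContDiff ℝ (⊤ : ℕ∞) v → Literature.Analysis.FluidPDE.VectorCalculus.IsDivFree v → (∀ x, ‖v x‖ ≤ M) → (∀ x, ‖fderiv ℝ v x‖ ≤ B) → (∫⁻ x, ‖iteratedFDeriv ℝ 0 v x‖ₑ ^ 2 < ⊤) → (∫⁻ x, ‖iteratedFDeriv ℝ 1 v x‖ₑ ^ 2 < ⊤) → (∫⁻ x, ‖iteratedFDeriv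 ℝ 2 v x‖ₑ ^ 2 < ⊤) → |∫ x, ⟪Literature.Analysis.FluidPDE.curl v x, fderiv ℝ v x (Literature.Analysis.FluidPDE.curl v x)⟫_ℝ| ≤ κ * M * Real.sqrt (∫ x, ‖Literature.Analysis.FluidPDE.curl v x‖ ^ 2) * Real.sqrt (∫ x, Literature.Analysis.FluidPDE.frobeniusNormSq (fderiv ℝ (Literature.Analysis.FluidPDE.curl v) x)))} → ∀ t₁ ∈ Set.Ico 0 T,
      volume {t : ℝ | t ∈ Set.Ico t₁ T ∧ (∃ M : ℝ, (∀ x, ‖u t x‖ ≤ M) ∧ m * M * Real.sqrt (∫ x, ‖Literature.Analysis.FluidPDE.curl (u t) x‖ ^ 2) * Real.sqrt (∫ x, Literature.Analysis.FluidPDE.frobeniusNormSq (fderiv ℝ (Literature.Analysis.FluidPDE.curl (u t)) x)) < |∫ x, ⟪Literature.Analysis.FluidPDE.curl (u t) x, fderiv ℝ (u t) x (Literature.Analysis.FluidPDE.curl (u t) x)⟫_ℝ|) ∧ (∫ x, ‖Literature.Analysis.FluidPDE.curl (u t) x‖ ^ 2) * Real.sqrt (T - t) ≤ A * (ν * Real.sqrt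 ν)} ≠ 0) :
    ∃ c₁ c₂ : ℝ, 0 < c₁ ∧ c₁ ≤ c₂ ∧ ∀ m : ℝ, 0 ≤ m → m < sInf {κ : ℝ | (∀ (v : EuclideanSpace ℝ (Fin 3) → EuclideanSpace ℝ (Fin 3)) (M B : ℝ), ContDiff ℝ (⊤ : ℕ∞) v → Literature.Analysis.FluidPDE.VectorCalculus.IsDivFree v → (∀ x, ‖v x‖ ≤ M) → (∀ x, ‖fderiv ℝ v x‖ ≤ B) → (∫⁻ x, ‖iteratedFDeriv ℝ 0 v x‖ₑ ^ 2 < ⊤) → (∫⁻ x, ‖iteratedFDeriv ℝ 1 v x‖ₑ ^ 2 < ⊤) → (∫⁻ x, ‖iteratedFDeriv ℝ 2 v x‖ₑ ^ 2 < ⊤) → |∫ x, ⟪Literature.Analysis.FluidPDE.curl v x, fderiv ℝ v x (Literature.Analysis.FluidPDE.curl v x)⟫_ℝ| ≤ κ * M * Real.sqrt (∫ x, ‖Literature.Analysis.FluidPDE.curl v x‖ ^ 2) * Real.sqrt (∫ x, Literature.Analysis.FluidPDE.frobeniusNormSq (fderiv ℝ (Literature.Analysis.FluidPDE.curl v) x)))}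 → ∀ t₁ ∈ Set.Ico 0 T,
      volume {t : ℝ | t ∈ Set.Ico t₁ T ∧ (∃ M : ℝ, (∀ x, ‖u t x‖ ≤ M) ∧ m * M * Real.sqrt (∫ x, ‖Literature.Analysis.FluidPDE.curl (u t) x‖ ^ 2) * Real.sqrt (∫ x, Literature.Analysis.FluidPDE.frobeniusNormSq (fderiv ℝ (Literature.Analysis.FluidPDE.curl (u t)) x)) < |∫ x, ⟪Literature.Analysis.FluidPDE.curl (u t) x, fderiv ℝ (u t) x (Literature.Analysis.FluidPDE.curl (u t) x)⟫_ℝ|) ∧ c₁ * (ν * (T - t)) * (∫ x, Literature.Analysis.FluidPDE.frobeniusNormSq (fderiv ℝ (Literature.Analysis.FluidPDE.curl (u t)) x)) ≤ (∫ x, ‖Literature.Analysis.FluidPDE.curl (u t) x‖ ^ 2) ∧ (∫ x, ‖Literature.Analysis.FluidPDE.curl (u t) x‖ ^ 2) ≤ c₂ * (ν * (T - t)) * (∫ x, Literature.Analysis.FluidPDE.frobeniusNormSq (fderiv ℝ (Literature.Analysis.FluidPDE.curl (u t)) x))} ≠ 0 :=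
  scaleLock_of_rates hν hT hsol hLH hdec (gradTypeIRate_of_typeIRate hC hν hT hsol hLH hdec hrate)
    (lerayLowerRate_of_not_extends hν hT hsol hLH hdec hext) henst

end Summit.NavierStokesRegularity.NavierStokesRegularity.Theorems.DepletionLadder.PerFlow

end
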